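import Mathlib.Analysis.Calculus.ContDiff.Operations
import Mathlib.Analysis.Calculus.Deriv.Mul
import Mathlib.Analysis.Calculus.Deriv.Comp
import Mathlib.Analysis.Calculus.Deriv.Prod
import Mathlib.Topology.OpenPartialHomeomorph.Basic
import HarnessLib

/-!
# Transplanting a compactly supported function through a chart; re-fibration along a flow box

General differential topology (topic `Geometry/Manifold`, companion of `FlowOutChart.lean`), proofs
plus one explicit definition.  Given an open partial homeomorphism `e : F × ℝ ⇀ G` (a chart of an
open piece of the Banach space `G`, e.g. the flow-out chart of a vector field `g` along a compact
set) and a function `u : F × ℝ → H` whose topological support is a compact subset of `e.source`,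
the **transplant** `chartTransplant e u : G → H` is `u ∘ e⁻¹` on `e.target` extended by `0`:
it is `C^n` when `u` and `e⁻¹` are (`contDiff_chartTransplant`), equals `u p` at `e p`, vanishes
off `e '' tsupport u`, and differentiates through the chart
(`fderiv_chartTransplant_apply`: `D(chartTransplant e u)_q v = Du_{e⁻¹ q} (D(e⁻¹)_q v)`).

Use (**re-fibration of a function along a flow box**, Lee 2012 Thm. 9.22-style coordinates): if in
the chart the field `g` is `∂_r`, i.e. `D(e⁻¹)_q (g q) = (0, 1)` (as provided by
`FlowOutChart.fderiv_flowOutChart_symm_apply_field`), then for `θ' := θ - chartTransplant e u`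

  `dθ'(g)(q) = dθ(g)(q) - ∂_r u (e⁻¹ q)`       (`fderiv_sub_chartTransplant_apply_field`),

so a modification `u(σ, r) = χ(σ) κ(r - r̂(σ)) E(σ)` with `|χ| ≤ 1`, `|κ'| ≤ k₁`, `|E| ≤ ε`
changes `dθ(g)` by at most `k₁ ε` (`fderiv_bumpProduct_zero_one`,
`abs_fderiv_sub_chartTransplant_bumpProduct_sub_le`) and keeps it positive when `k₁ ε < dθ(g)`
(`fderiv_sub_chartTransplant_bumpProduct_pos`), while `θ' = c` on the graph
`{e (σ, r̂ σ) : χ σ = 1}` when `κ 0 = 1` and `E σ = θ (e (σ, r̂ σ)) - c`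
(`sub_chartTransplant_bumpProduct_eq_on_graph`): the level set `{θ' = c}` of the new fibration
function passes through a prescribed compact graph over the transversal, `θ' = θ` away from it, and
`g` stays positively transverse to the new levels.  This is the local step "isotope the open book so
that the curve lies on a page" for a curve that is a graph over an `R`-transversal (seat of
`Literature.Geometry.Symplectic.palf_stein_supportedByBoundaryOpenBook`, Etnyre 2006, proof of
Thm. 5.5).

Everything is proved; definitions `chartTransplant`, `bumpProduct` (explicit formulas), no named fact.

## References

* J. M. Lee, *Introduction to Smooth Manifolds*, 2nd ed., GTM 218 (2012), Thm. 9.22 and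
  Lemma 2.26 (extension by zero of compactly supported smooth functions). [LeeSmoothManifolds2013]
* J. B. Etnyre, *Lectures on open book decompositions and contact structures*, Clay Math. Proc. 5
  (2006), proof of Thm. 5.5. [Etnyre2006]
-/

open Set Function Filter Topology

noncomputable section

namespace Literature.Geometry.Manifold

variable {F : Type*} [TopologicalSpace F] {G : Type*} [TopologicalSpace G]
  {H : Type*} [Zero H] {e : OpenPartialHomeomorph (F × ℝ) G} {u : F × ℝ → H}

/-! ### The transplant of a function through a chart -/

/-- **Transplant of `u` through the chart `e`**: `u ∘ e⁻¹` on `e.target`, `0` elsewhere.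
[cite: LeeSmoothManifolds2013, Lemma 2.26] -/
def chartTransplant (e : OpenPartialHomeomorph (F × ℝ) G) (u : F × ℝ → H) : G → H :=
  e.target.indicator (u ∘ e.symm)

/-- On the target the transplant is `u ∘ e⁻¹`. [folklore] -/
theorem chartTransplant_apply_of_mem {q : G} (hq : q ∈ e.target) :
    chartTransplant e u q = u (e.symm q) := by
  simp [chartTransplant, indicator_of_mem hq]

/-- Off the target the transplant vanishes. [folklore] -/
theorem chartTransplant_apply_of_not_mem {q : G} (hq : q ∉ e.target) :
    chartTransplant e u q = 0 := by
  simp [chartTransplant, indicator_of_notMem hq]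

/-- At a chart point: `chartTransplant e u (e p) = u p`. [folklore] -/
theorem chartTransplant_apply_image {p : F × ℝ} (hp : p ∈ e.source) :
    chartTransplant e u (e p) = u p := by
  rw [chartTransplant_apply_of_mem (e.map_source hp), e.left_inv hp]

/-- The transplant agrees with `u ∘ e⁻¹` near every point of the (open) target. [folklore] -/
theorem chartTransplant_eventuallyEq {q : G} (hq : q ∈ e.target) :
    chartTransplant e u =ᶠ[𝓝 q] u ∘ e.symm := by
  filter_upwards [e.open_target.mem_nhds hq] with q' hq'
  exact chartTransplant_apply_of_mem hq'

/-- **The transplant vanishes off `e '' tsupport u`** when `tsupport u ⊆ e.source`. [folklore] -/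
theorem chartTransplant_eq_zero [TopologicalSpace H] {q : G} (hq : q ∉ e '' tsupport u) : chartTransplant e u q = 0 := by
  by_cases hqt : q ∈ e.target
  · rw [chartTransplant_apply_of_mem hqt]
    apply image_eq_zero_of_notMem_tsupport
    intro hmem
    exact hq ⟨e.symm q, hmem, e.right_inv hqt⟩
  · exact chartTransplant_apply_of_not_mem hqt

/-- The image `e '' tsupport u` is compact (hence closed in a Hausdorff `G`) when `tsupport u` is a
compact subset of the source. [folklore] -/
theorem isCompact_image_tsupport [TopologicalSpace H] (hsub : tsupport u ⊆ e.source)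
    (hcpt : IsCompact (tsupport u)) : IsCompact (e '' tsupport u) :=
  hcpt.image_of_continuousOn (e.continuousOn.mono hsub)

/-- Off the compact `e '' tsupport u` the transplant is eventually `0`. [folklore] -/
theorem chartTransplant_eventuallyEq_zero [TopologicalSpace H] [T2Space G]
    (hsub : tsupport u ⊆ e.source) (hcpt : IsCompact (tsupport u)) {q : G}
    (hq : q ∉ e '' tsupport u) : chartTransplant e u =ᶠ[𝓝 q] fun _ => 0 := by
  have hcl : IsClosed (e '' tsupport u) := (isCompact_image_tsupport hsub hcpt).isClosed
  filter_upwards [hcl.isOpen_compl.mem_nhds hq] with q' hq'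
  exact chartTransplant_eq_zero hq'

end Literature.Geometry.Manifold

namespace Literature.Geometry.Manifold

variable {F : Type*} [NormedAddCommGroup F] [NormedSpace ℝ F]
  {G : Type*} [NormedAddCommGroup G] [NormedSpace ℝ G]
  {H : Type*} [NormedAddCommGroup H] [NormedSpace ℝ H]
  {e : OpenPartialHomeomorph (F × ℝ) G} {u : F × ℝ → H} {n : WithTop ℕ∞}

/-! ### Smoothness and derivative of the transplant -/

/-- **The transplant of a `C^n` function with compact support inside the source is `C^n`** (when
`e⁻¹` is `C^n` on the target). [cite: LeeSmoothManifolds2013, Lemma 2.26] -/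
theorem contDiff_chartTransplant (hu : ContDiff ℝ n u) (hsub : tsupport u ⊆ e.source)
    (hcpt : IsCompact (tsupport u)) (hsymm : ContDiffOn ℝ n e.symm e.target) :
    ContDiff ℝ n (chartTransplant e u) := by
  rw [contDiff_iff_contDiffAt]
  intro q
  by_cases hq : q ∈ e '' tsupport u
  · obtain ⟨p, hp, rfl⟩ := hq
    have hqt : e p ∈ e.target := e.map_source (hsub hp)
    have hcomp : ContDiffOn ℝ n (u ∘ e.symm) e.target := hu.comp_contDiffOn hsymm
    exact (hcomp.contDiffAt (e.open_target.mem_nhds hqt)).congr_of_eventuallyEq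
      (chartTransplant_eventuallyEq hqt)
  · exact (contDiffAt_const (c := (0 : H))).congr_of_eventuallyEq
      (chartTransplant_eventuallyEq_zero hsub hcpt hq)

/-- **Chain rule through the chart**: at `q ∈ e.target`,
`D(chartTransplant e u)_q v = Du_{e⁻¹ q} (D(e⁻¹)_q v)`. [folklore] -/
theorem fderiv_chartTransplant_apply {q : G} (hq : q ∈ e.target)
    (hd : DifferentiableAt ℝ e.symm q) (hu : DifferentiableAt ℝ u (e.symm q)) (v : G) :
    fderiv ℝ (chartTransplant e u) q v = fderiv ℝ u (e.symm q) (fderiv ℝ e.symm q v) := by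
  rw [(chartTransplant_eventuallyEq (u := u) hq).fderiv_eq, fderiv_comp q hu hd]
  rfl

omit [NormedSpace ℝ F] in
/-- Away from `e '' tsupport u` the transplant has derivative `0`. [folklore] -/
theorem fderiv_chartTransplant_of_not_mem (hsub : tsupport u ⊆ e.source)
    (hcpt : IsCompact (tsupport u)) {q : G} (hq : q ∉ e '' tsupport u) :
    fderiv ℝ (chartTransplant e u) q = 0 := by
  rw [(chartTransplant_eventuallyEq_zero hsub hcpt hq).fderiv_eq]
  exact fderiv_const_apply 0

/-! ### Modifying a function along a flow box: `θ' = θ - chartTransplant e u` -/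

/-- **Derivative of the modified function along the field**: if in the chart `g q` reads `(0, 1)`
(`D(e⁻¹)_q (g q) = (0, 1)`, the flow-box property), then
`D(θ - chartTransplant e u)_q (g q) = Dθ_q (g q) - Du_{e⁻¹ q} (0, 1)`.
[cite: LeeSmoothManifolds2013, Thm. 9.22] -/
theorem fderiv_sub_chartTransplant_apply_field {θ : G → H} {g : G → G} {q : G} (hq : q ∈ e.target)
    (hθ : DifferentiableAt ℝ θ q) (hd : DifferentiableAt ℝ e.symm q)
    (hu : DifferentiableAt ℝ u (e.symm q)) (hg : fderiv ℝ e.symm q (g q) = ((0 : F), (1 : ℝ))) :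
    fderiv ℝ (fun x => θ x - chartTransplant e u x) q (g q) =
      fderiv ℝ θ q (g q) - fderiv ℝ u (e.symm q) ((0 : F), (1 : ℝ)) := by
  have hct : DifferentiableAt ℝ (chartTransplant e u) q := by
    have : DifferentiableAt ℝ (u ∘ e.symm) q := hu.comp q hd
    exact this.congr_of_eventuallyEq (chartTransplant_eventuallyEq hq)
  rw [fderiv_fun_sub hθ hct]
  show fderiv ℝ θ q (g q) - fderiv ℝ (chartTransplant e u) q (g q) = _
  rw [fderiv_chartTransplant_apply hq hd hu, hg]

omit [NormedSpace ℝ F] in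
/-- Away from `e '' tsupport u` the modified function has the derivative of `θ`. [folklore] -/
theorem fderiv_sub_chartTransplant_of_not_mem {θ : G → H} (hsub : tsupport u ⊆ e.source)
    (hcpt : IsCompact (tsupport u)) {q : G} (hq : q ∉ e '' tsupport u)
    (hθ : DifferentiableAt ℝ θ q) :
    fderiv ℝ (fun x => θ x - chartTransplant e u x) q = fderiv ℝ θ q := by
  have hct : DifferentiableAt ℝ (chartTransplant e u) q :=
    (differentiableAt_const (0 : H)).congr_of_eventuallyEq
      (chartTransplant_eventuallyEq_zero hsub hcpt hq)
  rw [fderiv_fun_sub hθ hct, fderiv_chartTransplant_of_not_mem hsub hcpt hq, sub_zero]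

omit [NormedSpace ℝ F] [NormedSpace ℝ G] [NormedSpace ℝ H] in
/-- Away from `e '' tsupport u` the modified function IS `θ` (pointwise form). [folklore] -/
theorem sub_chartTransplant_of_not_mem {θ : G → H} {q : G}
    (hq : q ∉ e '' tsupport u) : θ q - chartTransplant e u q = θ q := by
  rw [chartTransplant_eq_zero hq, sub_zero]

/-! ### The bump-product modification `u(σ, r) = χ(σ) κ(r - r̂ σ) E(σ)` -/

/-- **The bump product** `u(σ, r) = χ(σ) · κ(r - r̂(σ)) · E(σ)`: a cut-off `χ` in the transversal
directions, a bump `κ` in the flow direction centred on the graph `r = r̂(σ)`, and the error `E` to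
be corrected. [cite: Etnyre2006, proof of Thm. 5.5] -/
def bumpProduct (χ : F → ℝ) (κ : ℝ → ℝ) (rhat E : F → ℝ) (p : F × ℝ) : ℝ :=
  χ p.1 * κ (p.2 - rhat p.1) * E p.1

omit [NormedAddCommGroup F] [NormedSpace ℝ F] in
/-- Unfolding. [folklore] -/
theorem bumpProduct_apply (χ : F → ℝ) (κ : ℝ → ℝ) (rhat E : F → ℝ) (p : F × ℝ) :
    bumpProduct χ κ rhat E p = χ p.1 * κ (p.2 - rhat p.1) * E p.1 := rfl

/-- The bump product is `C^n` for `C^n` data. [folklore] -/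
theorem contDiff_bumpProduct {χ : F → ℝ} {κ : ℝ → ℝ} {rhat E : F → ℝ} (hχ : ContDiff ℝ n χ)
    (hκ : ContDiff ℝ n κ) (hr : ContDiff ℝ n rhat) (hE : ContDiff ℝ n E) :
    ContDiff ℝ n (bumpProduct χ κ rhat E) := by
  unfold bumpProduct
  exact ((hχ.comp contDiff_fst).mul (hκ.comp (contDiff_snd.sub (hr.comp contDiff_fst)))).mul
    (hE.comp contDiff_fst)

/-- **`∂_r` of the bump product**: `Du_{(σ, r)} (0, 1) = χ(σ) κ'(r - r̂ σ) E(σ)`. [folklore] -/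
theorem fderiv_bumpProduct_zero_one {χ : F → ℝ} {κ : ℝ → ℝ} {rhat E : F → ℝ}
    (hu : Differentiable ℝ (bumpProduct χ κ rhat E)) (hκ : Differentiable ℝ κ) (p : F × ℝ) :
    fderiv ℝ (bumpProduct χ κ rhat E) p ((0 : F), (1 : ℝ)) =
      χ p.1 * deriv κ (p.2 - rhat p.1) * E p.1 := by
  -- restrict to the line `t ↦ (σ, r + t)`
  have hline : HasDerivAt (fun t : ℝ => ((p.1, p.2 + t) : F × ℝ)) ((0 : F), (1 : ℝ)) 0 := by
    refine (hasDerivAt_const (0 : ℝ) p.1).prodMk ?_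
    exact (hasDerivAt_id' (0 : ℝ)).const_add p.2
  have hcomp : HasDerivAt (bumpProduct χ κ rhat E ∘ fun t : ℝ => ((p.1, p.2 + t) : F × ℝ))
      (fderiv ℝ (bumpProduct χ κ rhat E) p ((0 : F), (1 : ℝ))) 0 :=
    (hu p).hasFDerivAt.comp_hasDerivAt_of_eq (0 : ℝ) hline (by simp)
  have hexp : HasDerivAt (bumpProduct χ κ rhat E ∘ fun t : ℝ => ((p.1, p.2 + t) : F × ℝ))
      (χ p.1 * deriv κ (p.2 - rhat p.1) * E p.1) 0 := by
    have hk : HasDerivAt (fun t : ℝ => κ (p.2 + t - rhat p.1)) (deriv κ (p.2 - rhat p.1)) 0 := by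
      have h1 : HasDerivAt (fun t : ℝ => p.2 + t - rhat p.1) 1 0 := by
        exact ((hasDerivAt_id' (0 : ℝ)).const_add p.2).sub_const (rhat p.1)
      have h2 := (hκ (p.2 + 0 - rhat p.1)).hasDerivAt
      have h3 := h2.comp (0 : ℝ) h1
      simpa [Function.comp_def] using h3
    have h := (hk.const_mul (χ p.1)).mul_const (E p.1)
    have hfun : (bumpProduct χ κ rhat E ∘ fun t : ℝ => ((p.1, p.2 + t) : F × ℝ)) =
        fun t => χ p.1 * κ (p.2 + t - rhat p.1) * E p.1 := by
      funext t
      simp [bumpProduct]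
    rw [hfun]
    simpa using h
  exact hcomp.unique hexp

/-- **The estimate**: with `|χ| ≤ 1`, `|κ'| ≤ k₁` and `|E σ| ≤ ε`, the modification changes the
derivative along the field by at most `k₁ ε`:
`|D(θ - chartTransplant e u)_q (g q) - Dθ_q (g q)| ≤ k₁ ε` at points of the target.
[cite: Etnyre2006, proof of Thm. 5.5] -/
theorem abs_fderiv_sub_chartTransplant_bumpProduct_sub_le {χ : F → ℝ} {κ : ℝ → ℝ}
    {rhat E : F → ℝ} {θ : G → ℝ} {g : G → G} {k₁ ε : ℝ} {q : G} (hq : q ∈ e.target)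
    (hθ : DifferentiableAt ℝ θ q) (hd : DifferentiableAt ℝ e.symm q)
    (hu : Differentiable ℝ (bumpProduct χ κ rhat E)) (hκ : Differentiable ℝ κ)
    (hg : fderiv ℝ e.symm q (g q) = ((0 : F), (1 : ℝ)))
    (hχ : |χ (e.symm q).1| ≤ 1) (hκ' : ∀ t, |deriv κ t| ≤ k₁) (hE : |E (e.symm q).1| ≤ ε) :
    |fderiv ℝ (fun x => θ x - chartTransplant e (bumpProduct χ κ rhat E) x) q (g q) -
      fderiv ℝ θ q (g q)| ≤ k₁ * ε := by
  rw [fderiv_sub_chartTransplant_apply_field hq hθ hd (hu _) hg, fderiv_bumpProduct_zero_one hu hκ]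
  have hk₁ : 0 ≤ k₁ := (abs_nonneg _).trans (hκ' 0)
  rw [show fderiv ℝ θ q (g q) - χ (e.symm q).1 * deriv κ ((e.symm q).2 - rhat (e.symm q).1) *
      E (e.symm q).1 - fderiv ℝ θ q (g q) = -(χ (e.symm q).1 *
      deriv κ ((e.symm q).2 - rhat (e.symm q).1) * E (e.symm q).1) by ring, abs_neg, abs_mul, abs_mul]
  calc |χ (e.symm q).1| * |deriv κ ((e.symm q).2 - rhat (e.symm q).1)| * |E (e.symm q).1|
      ≤ 1 * k₁ * ε := by
        apply mul_le_mul (mul_le_mul hχ (hκ' _) (abs_nonneg _) zero_le_one) hE (abs_nonneg _)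
        exact mul_nonneg zero_le_one hk₁
    _ = k₁ * ε := by ring

/-- **Positivity is preserved**: if moreover `m ≤ Dθ_q (g q)` and `k₁ ε < m` then
`0 < D(θ - chartTransplant e u)_q (g q)` — the field stays positively transverse to the levels of
the modified function. [cite: Etnyre2006, proof of Thm. 5.5] -/
theorem fderiv_sub_chartTransplant_bumpProduct_pos {χ : F → ℝ} {κ : ℝ → ℝ}
    {rhat E : F → ℝ} {θ : G → ℝ} {g : G → G} {k₁ ε m : ℝ} {q : G} (hq : q ∈ e.target)
    (hθ : DifferentiableAt ℝ θ q) (hd : DifferentiableAt ℝ e.symm q)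
    (hu : Differentiable ℝ (bumpProduct χ κ rhat E)) (hκ : Differentiable ℝ κ)
    (hg : fderiv ℝ e.symm q (g q) = ((0 : F), (1 : ℝ)))
    (hχ : |χ (e.symm q).1| ≤ 1) (hκ' : ∀ t, |deriv κ t| ≤ k₁) (hE : |E (e.symm q).1| ≤ ε)
    (hm : m ≤ fderiv ℝ θ q (g q)) (hsmall : k₁ * ε < m) :
    0 < fderiv ℝ (fun x => θ x - chartTransplant e (bumpProduct χ κ rhat E) x) q (g q) := by
  have h := abs_fderiv_sub_chartTransplant_bumpProduct_sub_le hq hθ hd hu hκ hg hχ hκ' hE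
  have h' := (abs_le.1 h).1
  linarith

omit [NormedSpace ℝ F] [NormedSpace ℝ G] in
/-- **The prescribed level**: on the graph `r = r̂(σ)` over the region `χ = 1`, with `κ 0 = 1` and
the error `E σ = θ (e (σ, r̂ σ)) - c`, the modified function takes the value `c`.
[cite: Etnyre2006, proof of Thm. 5.5] -/
theorem sub_chartTransplant_bumpProduct_eq_on_graph {χ : F → ℝ} {κ : ℝ → ℝ} {rhat E : F → ℝ}
    {θ : G → ℝ} {c : ℝ} {σ : F} (hsrc : (σ, rhat σ) ∈ e.source) (hχ : χ σ = 1) (hκ : κ 0 = 1)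
    (hE : E σ = θ (e (σ, rhat σ)) - c) :
    θ (e (σ, rhat σ)) - chartTransplant e (bumpProduct χ κ rhat E) (e (σ, rhat σ)) = c := by
  rw [chartTransplant_apply_image hsrc, bumpProduct_apply]
  simp [hχ, hκ, hE]

/-- Smoothness of the modified function. [folklore] -/
theorem contDiff_sub_chartTransplant {θ : G → H} (hθ : ContDiff ℝ n θ) (hu : ContDiff ℝ n u)
    (hsub : tsupport u ⊆ e.source) (hcpt : IsCompact (tsupport u))
    (hsymm : ContDiffOn ℝ n e.symm e.target) :
    ContDiff ℝ n fun x => θ x - chartTransplant e u x :=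
  hθ.sub (contDiff_chartTransplant hu hsub hcpt hsymm)

omit [NormedAddCommGroup F] [NormedSpace ℝ F] in
/-- The support of the bump product lies in `tsupport χ ×ˢ univ` intersected with the slab
`{|r - r̂ σ| ∈ tsupport κ}`: concretely, if `χ σ = 0` or `κ (r - r̂ σ) = 0` then `u (σ, r) = 0`;
this form (pointwise) is what support estimates use. [folklore] -/
theorem bumpProduct_eq_zero {χ : F → ℝ} {κ : ℝ → ℝ} {rhat E : F → ℝ} {p : F × ℝ}
    (h : χ p.1 = 0 ∨ κ (p.2 - rhat p.1) = 0) : bumpProduct χ κ rhat E p = 0 := by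
  rcases h with h | h <;> simp [bumpProduct, h]

omit [NormedSpace ℝ F] in
/-- **Support of the bump product**: `tsupport u ⊆ (tsupport χ) ×ˢ univ ∩ {p | p.2 - r̂ p.1 ∈ tsupport κ}`
when `r̂` is continuous. [folklore] -/
theorem tsupport_bumpProduct_subset {χ : F → ℝ} {κ : ℝ → ℝ} {rhat E : F → ℝ}
    (hr : Continuous rhat) :
    tsupport (bumpProduct χ κ rhat E) ⊆
      {p : F × ℝ | p.1 ∈ tsupport χ ∧ p.2 - rhat p.1 ∈ tsupport κ} := by
  -- the right-hand side is closed and contains the support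
  have hcl : IsClosed {p : F × ℝ | p.1 ∈ tsupport χ ∧ p.2 - rhat p.1 ∈ tsupport κ} := by
    refine IsClosed.inter ?_ ?_
    · exact (isClosed_tsupport χ).preimage continuous_fst
    · exact (isClosed_tsupport κ).preimage (continuous_snd.sub (hr.comp continuous_fst))
  refine closure_minimal (fun p hp => ?_) hcl
  rw [mem_support] at hp
  constructor
  · by_contra hχ
    exact hp (bumpProduct_eq_zero (Or.inl (image_eq_zero_of_notMem_tsupport hχ)))
  · by_contra hκ
    exact hp (bumpProduct_eq_zero (Or.inr (image_eq_zero_of_notMem_tsupport hκ)))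

omit [NormedSpace ℝ F] in
/-- **Compact support of the bump product** from compact supports of `χ` and `κ` and continuity
of `r̂`. [folklore] -/
theorem isCompact_tsupport_bumpProduct {χ : F → ℝ} {κ : ℝ → ℝ} {rhat E : F → ℝ}
    (hχ : IsCompact (tsupport χ)) (hκ : IsCompact (tsupport κ)) (hr : Continuous rhat) :
    IsCompact (tsupport (bumpProduct χ κ rhat E)) := by
  -- the set `{(σ, r) : σ ∈ tsupport χ, r - r̂ σ ∈ tsupport κ}` is the image of the compact
  -- `tsupport χ × tsupport κ` under the continuous shear `(σ, t) ↦ (σ, t + r̂ σ)`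
  have himage : {p : F × ℝ | p.1 ∈ tsupport χ ∧ p.2 - rhat p.1 ∈ tsupport κ} =
      (fun st : F × ℝ => ((st.1, st.2 + rhat st.1) : F × ℝ)) '' (tsupport χ ×ˢ tsupport κ) := by
    ext ⟨σ, r⟩
    constructor
    · rintro ⟨h1, h2⟩
      exact ⟨(σ, r - rhat σ), ⟨h1, h2⟩, by simp⟩
    · rintro ⟨⟨σ', t⟩, ⟨h1, h2⟩, h⟩
      simp only [Prod.mk.injEq] at h
      obtain ⟨rfl, rfl⟩ := h
      exact ⟨h1, by simpa using h2⟩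
  have hK : IsCompact {p : F × ℝ | p.1 ∈ tsupport χ ∧ p.2 - rhat p.1 ∈ tsupport κ} := by
    rw [himage]
    exact (hχ.prod hκ).image (by fun_prop)
  exact hK.of_isClosed_subset (isClosed_tsupport _) (tsupport_bumpProduct_subset hr)

end Literature.Geometry.Manifold

end
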